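import Summits.BirchSwinnertonDyer.BirchSwinnertonDyer.Theorems.ResidualThetaTransportAtTwoResidualSignedLambdaLowerCMAtTwoCoindShapiroOfFun
import Summits.BirchSwinnertonDyer.BirchSwinnertonDyer.Theorems.ThetaPartnerAtTwoSignedMainConjectureCMTwoRankZeroPTDeepSelmerTransport
import Literature.NumberTheory.EllipticCurves.CyclotomicLayerPairingOfFunMackeyLocal
import HarnessLib

/-!
# N4: the layer pairing `layerPairingH1Of … κ v n` is NON-DEGENERATE at EVERY finite place `v` (any number of places of `ℚ_n` above `v`)
# — local Tate duality for the layer field `ℚ_{n,v}` in the Shapiro model, via Mackey: the local Tate pairing of `Maps(Γ_ℚ ⧸ Γ_n, M)` at `v`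
# is the ORBIT SUM of the layer pairings of the components

Route `ResidualThetaTransportAtTwo` (RTT), crux RSL_g `ResidualSignedLambdaLowerCMAtTwo` (stmt-BirchSwinnertonDyer-22608); seat
`prover-bsd-wall-tp2-p2x` g17 (`--supports 22608 --as helper`, closes nothing). THEOREMS ONLY (no definition, no named fact, no instance
declaration, no `sorry`). STUB-PLAN rev 16 S66 (4) **N4**: «the prescribed component `b_i` realising a given functional on `H¹(ℚ_{n,w_i}, A_ρ[2^k])`
exists by LOCAL TATE DUALITY PERFECTNESS at `w_i` for the finite module — not by `hsurj_w` (no floor)» (T41). The companion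
`…CoindShapiroOfFun.lean` proves non-degeneracy at `v ∣ p` (ONE orbit, through the dual transport); here the MANY-ORBIT case (every finite `v`,
e.g. `w ∈ S₀`): for ANY finite discrete `Γ_ℚ`-module `M` with a non-degenerate pairing `e : M × M → μ_N`, `N • M = 0`, any `ℤ_p`-extension `κ`:

* §1 `localTatePairing_coind_cohomologyMap_eq_cupProduct_restrict` (GENERIC number field `K`, any open `U` of finite index, any place `v`,
  NO one-orbit hypothesis): `⟨a', H¹(Γ_{K_v}, Ψ) t⟩_v = a' ∪_{(Σ_{Γ_K⧸U} B)|_{Γ_{K_v}}} t` — the pull-free form of the tree's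
  `localTatePairing_coind_cohomologyMap_eq_cupProduct_pull` (same cocycle computation, without reindexing along `θ̄`).
* §2 **`eq_zero_of_forall_layerPairingH1Of_eq_zero`**: if `layerPairingH1Of ρM N e … κ v n x b = 0` for every `x ∈ H¹(U_n, M|)` then `b = 0`.
  Proof: take orbit representatives `g` (`exists_orbitReps_bijective`), the local class `u` with components `(Sh b at i₀, 0 elsewhere)`
  (`exists_cohomologyMap_resCoindFinHomR_eq`), read `⟨a', Ψ_v u⟩_v` as the orbit sum of layer pairings (§1 +
  `cupProduct_restrict_coindFin_eq_sum_orbits` + `layerPairingH1Of_apply`, first factors through `shapiroLift_surjective`) — it vanishes; so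
  `Ψ_v u = 0` by `⊤^⊥ = 0` for THE canonical maps (`eq_zero_of_forall_localTatePairingZMod_canonical_eq_zero`), `u = 0` (`Ψ` bijective), hence
  `Sh b = 0` and `b = 0` (`shapiroLift_injective`).
* §3 PERFECT FORM: `finite_layerH1` (`H¹(U_n, M|)` is finite — Shapiro into `H¹(ℚ_v, Maps(Γ_v ⧸ U_n, M|))`), `layerPairingH1Of_flip_bijective`
  / `layerPairingH1Of_bijective` (both adjoints bijective, counting `#Hom(H, ℤ/N) = #H`), **`existsUnique_layerPairingH1Of_eq`**: every
  functional `χ : H¹(U_n, M|) →+ ℤ/N` is `⟨·, b⟩_{n,N,v}` for a unique `b` — the PRESCRIBED place component of S66 (4) — and the left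
  non-degeneracy `eq_zero_of_forall_layerPairingH1Of_eq_zero_left`.
* §4 (appended) THE MANY-ORBIT KEY IN LAYER CURRENCY `localTatePairingZMod_canonical_coind_eq_sum_layerPairingH1Of`:
  `⟨a', H¹(Ψ_v) u⟩_v = Σ_i layerPairingH1Of (x i) (b i)` whenever `H¹(Φ_{g_i}) a' = Sh(x_i)`, `H¹(Φ_{g_i}) u = Sh(b_i)` (+ `exists_layerFamily_eq`).

References: [MilneADT2006] I Cor. 2.3 (local Tate duality), I §6 (proof of Prop. 6.9); [NeukirchSchmidtWingberg2008] I §5 Prop. (1.5.3)(iv),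
(1.5.6)–(1.5.7), I §6 (1.6.4)–(1.6.5); [Brown1982] III §5 (5.6)(b). BSD is not proved by any of this; RSL_g is not proved here.
-/

set_option autoImplicit false
-- the Theorems namespace of this sub repeats the summit name by design (D-0017 nested layout)
set_option linter.dupNamespace false

noncomputable section

open scoped Classical

universe u

namespace Summit.BirchSwinnertonDyer.BirchSwinnertonDyer.Theorems

namespace ThetaTransport.LayerPairingNondegenerate

open CategoryTheory Function Field NumberField IsDedekindDomain
  Literature.NumberTheory.EllipticCurves Literature.NumberTheory.EllipticCurves.CyclotomicLayer
  Literature.NumberTheory.GaloisRepresentations Literature.NumberTheory.GaloisRepresentations.DiscreteGaloisModule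
  Literature.NumberTheory.GaloisCohomology ZpExtension
open SignedLowerOffTwo.PTDeep (bijective_cohomologyMap_of_bijective eq_zero_of_forall_localTatePairingZMod_canonical_eq_zero)

/-! ## §1 The local Tate pairing of `Maps(Γ_K ⧸ U, M)` at `v` through `Ψ` as a restricted summed cup product (no one-orbit hypothesis) -/

section Local

variable {K : Type u} [Field K] [NumberField K] {M M' : Type u} [AddCommGroup M] [TopologicalSpace M] [DiscreteTopology M]
  [AddCommGroup M'] [TopologicalSpace M'] [DiscreteTopology M'] [Finite M]
  (ρ : DiscreteGaloisModule K M) (ρ' : DiscreteGaloisModule K M')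
  (U : Subgroup (absoluteGaloisGroup K)) [Fintype (absoluteGaloisGroup K ⧸ U)]
  {n : ℕ} (B : M →+ M' →+ MuCarrier K n)
  (hU : IsOpen (U : Set (absoluteGaloisGroup K)))
  (hB : ∀ (σ : absoluteGaloisGroup K) (m : M) (m' : M'), B (ρ σ m) (ρ' σ m') = mu K n σ (B m m'))
  (v : Place K)

/-- **`⟨a', H¹(Γ_{K_v}, Ψ) t⟩_v = a' ∪_{(Σ_{y ∈ Γ_K⧸U} B)|_{Γ_{K_v}}} t` in `H²(K_v, μₙ)`** for LOCAL classes `a' ∈ H¹(K_v, Maps(Γ_K ⧸ U, M))`,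
`t ∈ H¹(Γ_{K_v}, Maps(Γ_K ⧸ U, M')|_θ)`: the local Tate pairing (cup product for the evaluation pairing of the Tate dual) against the image of `t`
under `Ψ|_{Γ_{K_v}}` is the cup product for the SUMMED pairing restricted to `Γ_{K_v}` (on cocycles:
`ev(φ σ, Ψ(ψ τ)) = Σ_{y} B(φ σ y, ψ τ y)`, `tateDualEval_coindTateDualHom`). No hypothesis on the number of double cosets.
[cite: NeukirchSchmidtWingberg2008, I §5 Prop. (1.5.3)(iv)] [cite: MilneADT2006, Ch. I Cor. 2.3] -/
theorem localTatePairing_coind_cohomologyMap_eq_cupProduct_restrict [CompactSpace (absoluteGaloisGroup K)]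
    [CompactSpace (absoluteGaloisGroup (Place.Completion v))]
    (a' : continuousCohomology.{0, u, u} 1
      (TopRep.res (absGaloisRestrict K (Place.Completion v) : absoluteGaloisGroup (Place.Completion v) →* absoluteGaloisGroup K)
        (coindFin.{0, u} ρ.toTopRep U)))
    (t : continuousCohomology.{0, u, u} 1
      (TopRep.res (absGaloisRestrict K (Place.Completion v) : absoluteGaloisGroup (Place.Completion v) →* absoluteGaloisGroup K)
        (coindFin.{0, u} ρ'.toTopRep U))) :
    localTatePairing (ρ.coind U hU) n v a'
        (cohomologyMap (TopRep.ofHom ⟨(coindTateDualMor ρ ρ' U B hU hB).hom.toContinuousLinearMap, fun d =>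
            (coindTateDualMor ρ ρ' U B hU hB).hom.isIntertwining' (absGaloisRestrict K (Place.Completion v) d)⟩ :
          TopRep.res (absGaloisRestrict K (Place.Completion v) : absoluteGaloisGroup (Place.Completion v) →* absoluteGaloisGroup K)
            (coindFin.{0, u} ρ'.toTopRep U) ⟶ (((ρ.coind U hU).tateDual n).toLocal v).toTopRep) 1 t) =
      (((pairing ρ ρ' (mu K n) B hB).coindFin U).restrict (absGaloisRestrict K (Place.Completion v))).cupProduct a' t := by
  obtain ⟨f, rfl⟩ := oneCocycleClass_surjective _ a'
  obtain ⟨g, rfl⟩ := oneCocycleClass_surjective _ t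
  rw [cohomologyMap_oneCocycleClass, ContPairing.cupProduct_oneCocycleClass_eq_twoCocycleClass]
  erw [localTatePairing_oneCocycleClass, ContPairing.cupClass_eq_twoCocycleClass]
  congr 1
  apply Subtype.ext
  ext ⟨σ, τ⟩
  rw [ContPairing.cupCocycle_apply, ContPairing.cupCocycle_apply]
  repeat rw [pullback_id_resIdHom_apply]
  rw [map_sub, map_sub]
  refine congrArg₂ (· - ·) ?_ ?_ <;>
  · change tateDualEval K (absoluteGaloisGroup K ⧸ U → M) n (f.1 σ) (coindTateDualHom U B (g.1 _)) = _
    rw [tateDualEval_coindTateDualHom]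
    rfl

end Local

/-! ## §2 Non-degeneracy of the layer pairing at every finite place -/

section Layer

variable {M : Type} [AddCommGroup M] [TopologicalSpace M] [DiscreteTopology M] [Finite M]
  (ρM : DiscreteGaloisModule ℚ M) (N : ℕ) [NeZero N]
  (e : M → M → AlgebraicClosure ℚ)
  (hμ : ∀ S T, e S T ^ N = 1)
  (hadd₁ : ∀ S₁ S₂ T, e (S₁ + S₂) T = e S₁ T * e S₂ T)
  (hadd₂ : ∀ S T₁ T₂, e S (T₁ + T₂) = e S T₁ * e S T₂)
  (hgal : ∀ (σ : absoluteGaloisGroup ℚ) (S T : M), σ • e S T = e (ρM σ S) (ρM σ T))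
  {p : ℕ} [Fact p.Prime] (κ : ZpExtension ℚ p) (v : HeightOneSpectrum (𝓞 ℚ)) (n : ℕ)

/-- **N4 — the layer pairing is non-degenerate on the right at EVERY finite place `v`** (local Tate duality for `ℚ_{n,v}` in the Shapiro
model; any number `#ι` of places of `ℚ_n` above `v`): if `layerPairingH1Of ρM N e … κ v n x b = 0` for all `x ∈ H¹(U_n, M|)` then `b = 0`.
Mackey road: orbit representatives `g` (`exists_orbitReps_bijective`); the local class `u ∈ H¹(Γ_v, Maps(Γ_ℚ ⧸ Γ_n, M)|_θ)` with components
`(Sh b at i₀, 0 elsewhere)` (`exists_cohomologyMap_resCoindFinHomR_eq`); for every `a'` the local Tate pairing `⟨a', Ψ_v u⟩_v` is the orbit sum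
of the layer pairings of the components (§1 + `cupProduct_restrict_coindFin_eq_sum_orbits`), whose only possibly non-zero term is
`layerPairingH1Of x b` with `Sh x = H¹(Φ_{i₀}) a'` (`shapiroLift_surjective`) — zero by hypothesis; so `Ψ_v u ∈ ⊤^⊥ = 0`
(`eq_zero_of_forall_localTatePairingZMod_canonical_eq_zero`), `u = 0` (`Ψ` bijective for `e` non-degenerate), `Sh b = H¹(Φ_{i₀}) u = 0`, `b = 0`.
[cite: MilneADT2006, Ch. I Cor. 2.3, Ch. I §6 (proof of Prop. 6.9)] [cite: NeukirchSchmidtWingberg2008, I §5 (1.5.6)–(1.5.7), I §6 (1.6.4)] -/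
theorem eq_zero_of_forall_layerPairingH1Of_eq_zero [CompactSpace (absoluteGaloisGroup ℚ)]
    [CompactSpace (absoluteGaloisGroup (v.adicCompletion ℚ))] [Fintype (absoluteGaloisGroup ℚ ⧸ κ.layerSubgroup n)]
    (hnondeg : ∀ T, (∀ S, e S T = 1) → T = 0) (hN : ∀ m : M, N • m = 0)
    (b : continuousCohomology 1 (subgroupRep (localRepOf ρM v) (layerGroup κ v n)))
    (hb : ∀ x : continuousCohomology 1 (subgroupRep (localRepOf ρM v) (layerGroup κ v n)),
      layerPairingH1Of ρM N e hμ hadd₁ hadd₂ hgal κ v n x b = 0) :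
    b = 0 := by
  -- the local instances in the `Place.Completion` spelling of the Literature lemmas (`Place.Completion (Sum.inr v) = ℚ_v`)
  haveI : CompactSpace (absoluteGaloisGroup (Place.Completion (Sum.inr v : Place ℚ))) :=
    ‹CompactSpace (absoluteGaloisGroup (v.adicCompletion ℚ))›
  haveI : (κ.layerSubgroup n).FiniteIndex := Subgroup.finiteIndex_of_finite_quotient
  letI hFq : Fintype (absoluteGaloisGroup (v.adicCompletion ℚ) ⧸
      (κ.layerSubgroup n).comap ((resGalOfEmb (closureEmb (K := ℚ) (v.adicCompletion ℚ)) :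
        absoluteGaloisGroup (v.adicCompletion ℚ) →* absoluteGaloisGroup ℚ))) :=
    layerFintypeQuot κ v n
  -- orbit representatives (Mackey)
  obtain ⟨ι, hι, g, hbij⟩ := exists_orbitReps_bijective (κ.layerSubgroup n)
    (resGalOfEmb (closureEmb (K := ℚ) (v.adicCompletion ℚ)))
  -- the local class `u` with components `Sh (b at i₀, 0 elsewhere)`; first: is `ι` empty? then `H¹(U_n, ·)`'s Shapiro target is reached by no
  -- orbit — impossible since `D ⧸ U_n` is non-empty; we only need one index `i₀` with `g i₀ ∈` the orbit of `1`
  obtain ⟨⟨i₀, y₀⟩, hy₀⟩ := hbij.2 ((1 : absoluteGaloisGroup ℚ) : absoluteGaloisGroup ℚ ⧸ κ.layerSubgroup n)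
  let bfam : ι → continuousCohomology 1 (subgroupRep (localRepOf ρM v) (layerGroup κ v n)) := fun i => if i = i₀ then b else 0
  obtain ⟨u, hu⟩ := exists_cohomologyMap_resCoindFinHomR_eq_shapiroLift ρM.toTopRep (κ.layerSubgroup n)
    (resGalOfEmb (closureEmb (K := ℚ) (v.adicCompletion ℚ))) (κ.isOpen_layerSubgroup n) g hbij
    (layerReps_spec κ v n) (layerReps_one κ v n) bfam
  -- `Ψ` restricted to `Γ_v`, in the spelling of §1
  let Ψv : TopRep.res (absGaloisRestrict ℚ (Place.Completion (Sum.inr v : Place ℚ)) :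
      absoluteGaloisGroup (Place.Completion (Sum.inr v : Place ℚ)) →* absoluteGaloisGroup ℚ)
        (coindFin.{0, 0} ρM.toTopRep (κ.layerSubgroup n)) ⟶
      (((ρM.coind (κ.layerSubgroup n) (κ.isOpen_layerSubgroup n)).tateDual N).toLocal (Sum.inr v)).toTopRep :=
    TopRep.ofHom ⟨(coindTateDualMor ρM ρM (κ.layerSubgroup n) (pairingHomOfFun N e hμ hadd₁ hadd₂) (κ.isOpen_layerSubgroup n)
        (fun σ S T => (contPairingOfFun ρM N e hμ hadd₁ hadd₂ hgal).toLin_smul σ S T)).hom.toContinuousLinearMap, fun d =>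
      (coindTateDualMor ρM ρM (κ.layerSubgroup n) (pairingHomOfFun N e hμ hadd₁ hadd₂) (κ.isOpen_layerSubgroup n)
        (fun σ S T => (contPairingOfFun ρM N e hμ hadd₁ hadd₂ hgal).toLin_smul σ S T)).hom.isIntertwining'
          (absGaloisRestrict ℚ (Place.Completion (Sum.inr v : Place ℚ)) d)⟩
  -- (1) every local Tate pairing value against `Ψ_v u` vanishes
  have hpair : ∀ a' : galoisCohomology ((ρM.coind (κ.layerSubgroup n) (κ.isOpen_layerSubgroup n)).toLocal (Sum.inr v)) 1,
      localTatePairingZMod (ρM.coind (κ.layerSubgroup n) (κ.isOpen_layerSubgroup n)) N (Sum.inr v)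
        (LocalInvariants.canonical ℚ N (Sum.inr v)) a' (cohomologyMap Ψv 1 u) = 0 := by
    intro a'
    rw [localTatePairingZMod_apply]
    have key := localTatePairing_coind_cohomologyMap_eq_cupProduct_restrict ρM ρM (κ.layerSubgroup n)
      (pairingHomOfFun N e hμ hadd₁ hadd₂) (κ.isOpen_layerSubgroup n)
      (fun σ S T => (contPairingOfFun ρM N e hμ hadd₁ hadd₂ hgal).toLin_smul σ S T) (Sum.inr v) a' u
    rw [key]
    -- orbit sum, read in the layer currency
    have hsum : (((pairing ρM ρM (mu ℚ N) (pairingHomOfFun N e hμ hadd₁ hadd₂)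
          (fun σ S T => (contPairingOfFun ρM N e hμ hadd₁ hadd₂ hgal).toLin_smul σ S T)).coindFin (κ.layerSubgroup n)).restrict
          (absGaloisRestrict ℚ (Place.Completion (Sum.inr v : Place ℚ)))).cupProduct a' u =
        ∑ i, (layerSumPairingOf ρM N e hμ hadd₁ hadd₂ hgal κ v n).cupProduct
          (cohomologyMap (resCoindFinHomR ρM.toTopRep (κ.layerSubgroup n)
            (resGalOfEmb (closureEmb (K := ℚ) (v.adicCompletion ℚ))) (g i : absoluteGaloisGroup ℚ ⧸ κ.layerSubgroup n)) 1 a')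
          (layerShapiroOf ρM κ v n (bfam i)) := by
      refine (cupProduct_restrict_coindFin_eq_sum_orbits (contPairingOfFun ρM N e hμ hadd₁ hadd₂ hgal) (κ.layerSubgroup n)
        (resGalOfEmb (closureEmb (K := ℚ) (v.adicCompletion ℚ))) g hbij a' u).trans (Finset.sum_congr rfl fun i _ => ?_)
      calc _ = (layerSumPairingOf ρM N e hμ hadd₁ hadd₂ hgal κ v n).cupProduct
            (cohomologyMap (resCoindFinHomR ρM.toTopRep (κ.layerSubgroup n)
              (resGalOfEmb (closureEmb (K := ℚ) (v.adicCompletion ℚ))) (g i : absoluteGaloisGroup ℚ ⧸ κ.layerSubgroup n)) 1 a')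
            (cohomologyMap (resCoindFinHomR ρM.toTopRep (κ.layerSubgroup n)
              (resGalOfEmb (closureEmb (K := ℚ) (v.adicCompletion ℚ))) (g i : absoluteGaloisGroup ℚ ⧸ κ.layerSubgroup n)) 1 u) := rfl
        _ = _ := by rw [hu i]; rfl
    have hsum' := congrArg (invAt N v) hsum
    rw [map_sum] at hsum'
    refine hsum'.trans (Finset.sum_eq_zero fun i _ => ?_)
    -- the `i`-th term: first factor is a layer Shapiro lift, second is `Sh (bfam i)`
    obtain ⟨x, hx⟩ := shapiroLift_surjective (localRepOf ρM v) (layerGroup κ v n) (isOpen_layerGroup κ v n)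
      (layerReps_spec κ v n) (layerReps_one κ v n)
      (cohomologyMap (resCoindFinHomR ρM.toTopRep (κ.layerSubgroup n)
        (resGalOfEmb (closureEmb (K := ℚ) (v.adicCompletion ℚ))) (g i : absoluteGaloisGroup ℚ ⧸ κ.layerSubgroup n)) 1 a')
    have hterm : invAt N v ((layerSumPairingOf ρM N e hμ hadd₁ hadd₂ hgal κ v n).cupProduct
        (cohomologyMap (resCoindFinHomR ρM.toTopRep (κ.layerSubgroup n)
          (resGalOfEmb (closureEmb (K := ℚ) (v.adicCompletion ℚ))) (g i : absoluteGaloisGroup ℚ ⧸ κ.layerSubgroup n)) 1 a')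
        (layerShapiroOf ρM κ v n (bfam i))) = layerPairingH1Of ρM N e hμ hadd₁ hadd₂ hgal κ v n x (bfam i) := by
      rw [layerPairingH1Of_apply, ← hx]
      rfl
    rw [hterm]
    by_cases hi : i = i₀
    · subst hi
      simp only [bfam, if_true]
      exact hb x
    · simp only [bfam, if_neg hi, map_zero]
  -- (2) hence `Ψ_v u = 0` (`⊤^⊥ = 0` for THE canonical maps), `u = 0` (`Ψ` injective on `H¹`), `Sh b = 0`, `b = 0`
  have hM : ∀ m : absoluteGaloisGroup ℚ ⧸ κ.layerSubgroup n → M, N • m = 0 := fun φ => funext fun y => hN (φ y)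
  have hΨu : cohomologyMap Ψv 1 u = 0 :=
    eq_zero_of_forall_localTatePairingZMod_canonical_eq_zero N (ρM.coind (κ.layerSubgroup n) (κ.isOpen_layerSubgroup n)) hM v _
      hpair
  have hΨinj : Function.Injective (cohomologyMap Ψv 1) := by
    haveI : DiscreteTopology (TopRep.res (absGaloisRestrict ℚ (Place.Completion (Sum.inr v : Place ℚ)) :
        absoluteGaloisGroup (Place.Completion (Sum.inr v : Place ℚ)) →* absoluteGaloisGroup ℚ)
          (coindFin.{0, 0} ρM.toTopRep (κ.layerSubgroup n))) :=
      inferInstanceAs (DiscreteTopology (absoluteGaloisGroup ℚ ⧸ κ.layerSubgroup n → M))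
    haveI : DiscreteTopology ((((ρM.coind (κ.layerSubgroup n) (κ.isOpen_layerSubgroup n)).tateDual N).toLocal
        (Sum.inr v)).toTopRep) :=
      inferInstanceAs (DiscreteTopology (TateDual ℚ (absoluteGaloisGroup ℚ ⧸ κ.layerSubgroup n → M) N))
    refine (bijective_cohomologyMap_of_bijective Ψv ?_ 1).1
    exact coindTateDualHom_bijective (κ.layerSubgroup n) (pairingHomOfFun N e hμ hadd₁ hadd₂)
      (CoindShapiroOfFun.bijective_pairingHomOfFun_flip N e hμ hadd₁ hadd₂ hnondeg hN)
  have hu0 : u = 0 := hΨinj (hΨu.trans (map_zero _).symm)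
  have hSh : layerShapiroOf ρM κ v n b = 0 := by
    have h := hu i₀
    rw [hu0, map_zero] at h
    simp only [bfam, if_true] at h
    exact h.symm
  have hShinj := shapiroLift_injective (localRepOf ρM v) (layerGroup κ v n) (isOpen_layerGroup κ v n)
    (layerReps_spec κ v n) (layerReps_one κ v n)
  exact hShinj (hSh.trans (map_zero _).symm)

/-! ## §3 Perfectness: `H¹(U_n, M|)` is finite and the layer pairing realises EVERY functional `χ : H¹(U_n, M|) →+ ℤ/N` -/

/-- **`H¹(U_n, M|)` is finite**: by Shapiro (`layerShapiroOf` injective) it embeds in `H¹(ℚ_v, Maps(Γ_v ⧸ U_n, M|))`, the first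
cohomology of a `p`-adic field with finite coefficients (`finite_galoisCohomology_one_adicCompletion`, Serre II §5.2 Prop. 14).
[cite: MilneADT2006, Ch. I Cor. 2.3] [cite: NeukirchSchmidtWingberg2008, I §6 Prop. (1.6.4)] -/
theorem finite_layerH1 : Finite (continuousCohomology 1 (subgroupRep (localRepOf ρM v) (layerGroup κ v n))) := by
  letI : Fintype (absoluteGaloisGroup (v.adicCompletion ℚ) ⧸ layerGroup κ v n) := layerFintypeQuot κ v n
  haveI : Finite (continuousCohomology 1 (coindFin.{0, 0} (localRepOf ρM v) (layerGroup κ v n))) :=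
    finite_galoisCohomology_one_adicCompletion v
      (DiscreteGaloisModule.coind (K := v.adicCompletion ℚ) (GaloisRep.restrictField (v.adicCompletion ℚ) ρM)
        (layerGroup κ v n) (isOpen_layerGroup κ v n))
  exact Finite.of_injective _ (shapiroLift_injective (localRepOf ρM v) (layerGroup κ v n) (isOpen_layerGroup κ v n)
    (layerReps_spec κ v n) (layerReps_one κ v n))

omit [Finite M] [NeZero N] in
/-- `H¹(U_n, M|)` is killed by `N` when `M` is. [cite: MilneADT2006, Ch. I §0] -/
theorem nsmul_layerH1_eq_zero (hN : ∀ m : M, N • m = 0)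
    (x : continuousCohomology 1 (subgroupRep (localRepOf ρM v) (layerGroup κ v n))) : N • x = 0 :=
  nsmul_continuousCohomology_one_eq_zero _ N hN x

/-- **N4, perfect form — the right adjoint `b ↦ ⟨·, b⟩_{n,N,v}` of the layer pairing is BIJECTIVE onto `Hom(H¹(U_n, M|), ℤ/N)`**
at every finite place `v`: injective by `eq_zero_of_forall_layerPairingH1Of_eq_zero`, onto by counting (`#Hom(H, ℤ/N) = #H` for the
finite `N`-torsion group `H = H¹(U_n, M|)`). [cite: MilneADT2006, Ch. I Cor. 2.3, Ch. I §0 Prop. 0.19] [cite: SerreGaloisCohomology1997, II §5.2 Thm. 2] -/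
theorem layerPairingH1Of_flip_bijective [CompactSpace (absoluteGaloisGroup ℚ)]
    [CompactSpace (absoluteGaloisGroup (v.adicCompletion ℚ))] [Fintype (absoluteGaloisGroup ℚ ⧸ κ.layerSubgroup n)]
    (hnondeg : ∀ T, (∀ S, e S T = 1) → T = 0) (hN : ∀ m : M, N • m = 0) :
    Function.Bijective (layerPairingH1Of ρM N e hμ hadd₁ hadd₂ hgal κ v n).flip := by
  haveI := finite_layerH1 ρM κ v n
  haveI := finite_addMonoidHom_zmod (continuousCohomology 1 (subgroupRep (localRepOf ρM v) (layerGroup κ v n))) N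
  have hinj : Function.Injective (layerPairingH1Of ρM N e hμ hadd₁ hadd₂ hgal κ v n).flip := by
    rw [injective_iff_map_eq_zero]
    intro b hb
    exact eq_zero_of_forall_layerPairingH1Of_eq_zero ρM N e hμ hadd₁ hadd₂ hgal κ v n hnondeg hN b fun x => by
      rw [← AddMonoidHom.flip_apply, hb, AddMonoidHom.zero_apply]
  exact (Nat.bijective_iff_injective_and_card _).2
    ⟨hinj, (Nat.card_addMonoidHom_zmod (nsmul_layerH1_eq_zero ρM N κ v n hN)).symm⟩

/-- **Both adjoints of the layer pairing are bijective** (local Tate duality for `ℚ_{n,v}` with coefficients `M`, in the Shapiro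
model, at every finite `v`): from `layerPairingH1Of_flip_bijective` by `AddMonoidHom.bijective_of_bijective_flip`.
[cite: MilneADT2006, Ch. I Cor. 2.3] [cite: SerreGaloisCohomology1997, II §5.2 Thm. 2] -/
theorem layerPairingH1Of_bijective [CompactSpace (absoluteGaloisGroup ℚ)]
    [CompactSpace (absoluteGaloisGroup (v.adicCompletion ℚ))] [Fintype (absoluteGaloisGroup ℚ ⧸ κ.layerSubgroup n)]
    (hnondeg : ∀ T, (∀ S, e S T = 1) → T = 0) (hN : ∀ m : M, N • m = 0) :
    Function.Bijective (layerPairingH1Of ρM N e hμ hadd₁ hadd₂ hgal κ v n) ∧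
      Function.Bijective (layerPairingH1Of ρM N e hμ hadd₁ hadd₂ hgal κ v n).flip := by
  haveI := finite_layerH1 ρM κ v n
  exact AddMonoidHom.bijective_of_bijective_flip (nsmul_layerH1_eq_zero ρM N κ v n hN) (nsmul_layerH1_eq_zero ρM N κ v n hN) _
    (layerPairingH1Of_flip_bijective ρM N e hμ hadd₁ hadd₂ hgal κ v n hnondeg hN)

/-- **Every functional `χ : H¹(U_n, M|) →+ ℤ/N` is `⟨·, b⟩_{n,N,v}` for a UNIQUE layer class `b`** — the form used to PRESCRIBE the place
components of a local class at `v ∈ S₀` (STUB-PLAN S66 (4): «exists by local Tate duality perfectness at `w_i`, not by `hsurj_w`»).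
[cite: MilneADT2006, Ch. I Cor. 2.3] [cite: Kobayashi2003, (8.23) (p. 18)] -/
theorem existsUnique_layerPairingH1Of_eq [CompactSpace (absoluteGaloisGroup ℚ)]
    [CompactSpace (absoluteGaloisGroup (v.adicCompletion ℚ))] [Fintype (absoluteGaloisGroup ℚ ⧸ κ.layerSubgroup n)]
    (hnondeg : ∀ T, (∀ S, e S T = 1) → T = 0) (hN : ∀ m : M, N • m = 0)
    (χ : continuousCohomology 1 (subgroupRep (localRepOf ρM v) (layerGroup κ v n)) →+ ZMod N) :
    ∃! b : continuousCohomology 1 (subgroupRep (localRepOf ρM v) (layerGroup κ v n)),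
      ∀ x, layerPairingH1Of ρM N e hμ hadd₁ hadd₂ hgal κ v n x b = χ x := by
  have hbij := layerPairingH1Of_flip_bijective ρM N e hμ hadd₁ hadd₂ hgal κ v n hnondeg hN
  obtain ⟨b, hb⟩ := hbij.2 χ
  refine ⟨b, fun x => ?_, fun b' hb' => hbij.1 (hb'' b' hb' |>.trans hb.symm)⟩
  · rw [← AddMonoidHom.flip_apply, hb]
  where
  /-- the functional of `b'` is `χ` -/
  hb'' (b' : continuousCohomology 1 (subgroupRep (localRepOf ρM v) (layerGroup κ v n)))
      (hb' : ∀ x, layerPairingH1Of ρM N e hμ hadd₁ hadd₂ hgal κ v n x b' = χ x) :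
      (layerPairingH1Of ρM N e hμ hadd₁ hadd₂ hgal κ v n).flip b' = χ :=
    AddMonoidHom.ext fun x => by rw [AddMonoidHom.flip_apply, hb' x]

/-- **Left non-degeneracy** (the other adjoint): `⟨x, b⟩_{n,N,v} = 0` for all `b` forces `x = 0`. [cite: MilneADT2006, Ch. I Cor. 2.3] -/
theorem eq_zero_of_forall_layerPairingH1Of_eq_zero_left [CompactSpace (absoluteGaloisGroup ℚ)]
    [CompactSpace (absoluteGaloisGroup (v.adicCompletion ℚ))] [Fintype (absoluteGaloisGroup ℚ ⧸ κ.layerSubgroup n)]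
    (hnondeg : ∀ T, (∀ S, e S T = 1) → T = 0) (hN : ∀ m : M, N • m = 0)
    (x : continuousCohomology 1 (subgroupRep (localRepOf ρM v) (layerGroup κ v n)))
    (hx : ∀ b : continuousCohomology 1 (subgroupRep (localRepOf ρM v) (layerGroup κ v n)),
      layerPairingH1Of ρM N e hμ hadd₁ hadd₂ hgal κ v n x b = 0) :
    x = 0 := by
  refine (injective_iff_map_eq_zero _).1 (layerPairingH1Of_bijective ρM N e hμ hadd₁ hadd₂ hgal κ v n hnondeg hN).1.1 x ?_
  exact AddMonoidHom.ext hx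

/-! ## §4 The MANY-ORBIT key in LAYER currency (the `S₀`-twin of `…CoindShapiroOfFun` §2) -/

/-- **`⟨a', H¹(Ψ_v) u⟩_v (mod N, canonical) = Σ_i ⟨x_i, b_i⟩_{n,N,v}`** at EVERY finite `v`: for orbit representatives `g` (`hbij`), local
classes `a' ∈ H¹(ℚ_v, Maps(Γ_ℚ ⧸ Γ_n, M))`, `u ∈ H¹(Γ_v, Maps(Γ_ℚ ⧸ Γ_n, M)|_θ)` and layer classes with `H¹(Φ_{g_iΓ_n}) a' = Sh(x_i)`,
`H¹(Φ_{g_iΓ_n}) u = Sh(b_i)`: the local Tate pairing mod `N` (canonical invariant maps) of `a'` with `H¹(Γ_v, Ψ) u` (= `loc_v (H¹(Ψ) ·)` of a global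
class by `localization_cohomologyMap_coindTateDualMor`) is `Σ_i layerPairingH1Of (x i) (b i)` — §1 + `cupProduct_restrict_coindFin_eq_sum_orbits`
in the layer currency; `x`, `b` exist by `exists_layerFamily_eq`, `u` with PRESCRIBED `b` by `exists_cohomologyMap_resCoindFinHomR_eq_shapiroLift`.
[cite: NeukirchSchmidtWingberg2008, I §5 Prop. (1.5.3) (iv), I §6 Prop. (1.6.5)] [cite: MilneADT2006, Ch. I §6 (proof of Prop. 6.9)] -/
theorem localTatePairingZMod_canonical_coind_eq_sum_layerPairingH1Of [CompactSpace (absoluteGaloisGroup ℚ)]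
    [CompactSpace (absoluteGaloisGroup (v.adicCompletion ℚ))] [Fintype (absoluteGaloisGroup ℚ ⧸ κ.layerSubgroup n)]
    {ι : Type} [Fintype ι] (g : ι → absoluteGaloisGroup ℚ)
    (hbij : Function.Bijective fun q : ι × (absoluteGaloisGroup (v.adicCompletion ℚ) ⧸ layerGroup κ v n) =>
      quotientMapOfHom (κ.layerSubgroup n) (resGalOfEmb (closureEmb (K := ℚ) (v.adicCompletion ℚ))) q.2 *
        (g q.1 : absoluteGaloisGroup ℚ ⧸ κ.layerSubgroup n))
    (a' : galoisCohomology ((ρM.coind (κ.layerSubgroup n) (κ.isOpen_layerSubgroup n)).toLocal (Sum.inr v)) 1)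
    (u : continuousCohomology 1 (TopRep.res (resGalOfEmb (closureEmb (K := ℚ) (v.adicCompletion ℚ)) :
      absoluteGaloisGroup (v.adicCompletion ℚ) →* absoluteGaloisGroup ℚ) (coindFin ρM.toTopRep (κ.layerSubgroup n))))
    (x b : ι → continuousCohomology 1 (subgroupRep (localRepOf ρM v) (layerGroup κ v n)))
    (hx : ∀ i, cohomologyMap (resCoindFinHomR ρM.toTopRep (κ.layerSubgroup n) (resGalOfEmb (closureEmb (K := ℚ) (v.adicCompletion ℚ)))
        (g i : absoluteGaloisGroup ℚ ⧸ κ.layerSubgroup n)) 1 a' = layerShapiroOf ρM κ v n (x i))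
    (hb : ∀ i, cohomologyMap (resCoindFinHomR ρM.toTopRep (κ.layerSubgroup n) (resGalOfEmb (closureEmb (K := ℚ) (v.adicCompletion ℚ)))
        (g i : absoluteGaloisGroup ℚ ⧸ κ.layerSubgroup n)) 1 u = layerShapiroOf ρM κ v n (b i)) :
    localTatePairingZMod (ρM.coind (κ.layerSubgroup n) (κ.isOpen_layerSubgroup n)) N (Sum.inr v)
        (LocalInvariants.canonical ℚ N (Sum.inr v)) a'
        (cohomologyMap (TopRep.ofHom ⟨(coindTateDualMor ρM ρM (κ.layerSubgroup n) (pairingHomOfFun N e hμ hadd₁ hadd₂)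
            (κ.isOpen_layerSubgroup n) (fun σ S T => (contPairingOfFun ρM N e hμ hadd₁ hadd₂ hgal).toLin_smul σ S T)).hom.toContinuousLinearMap,
            fun d => (coindTateDualMor ρM ρM (κ.layerSubgroup n) (pairingHomOfFun N e hμ hadd₁ hadd₂) (κ.isOpen_layerSubgroup n)
              (fun σ S T => (contPairingOfFun ρM N e hμ hadd₁ hadd₂ hgal).toLin_smul σ S T)).hom.isIntertwining'
                (absGaloisRestrict ℚ (Place.Completion (Sum.inr v : Place ℚ)) d)⟩ :
          TopRep.res (absGaloisRestrict ℚ (Place.Completion (Sum.inr v : Place ℚ)) :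
              absoluteGaloisGroup (Place.Completion (Sum.inr v : Place ℚ)) →* absoluteGaloisGroup ℚ)
              (coindFin.{0, 0} ρM.toTopRep (κ.layerSubgroup n)) ⟶
            (((ρM.coind (κ.layerSubgroup n) (κ.isOpen_layerSubgroup n)).tateDual N).toLocal (Sum.inr v)).toTopRep) 1 u) =
      ∑ i, layerPairingH1Of ρM N e hμ hadd₁ hadd₂ hgal κ v n (x i) (b i) := by
  haveI : CompactSpace (absoluteGaloisGroup (Place.Completion (Sum.inr v : Place ℚ))) :=
    ‹CompactSpace (absoluteGaloisGroup (v.adicCompletion ℚ))›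
  letI hFq : Fintype (absoluteGaloisGroup (v.adicCompletion ℚ) ⧸
      (κ.layerSubgroup n).comap ((resGalOfEmb (closureEmb (K := ℚ) (v.adicCompletion ℚ)) :
        absoluteGaloisGroup (v.adicCompletion ℚ) →* absoluteGaloisGroup ℚ))) :=
    layerFintypeQuot κ v n
  rw [localTatePairingZMod_apply, localTatePairing_coind_cohomologyMap_eq_cupProduct_restrict ρM ρM (κ.layerSubgroup n)
    (pairingHomOfFun N e hμ hadd₁ hadd₂) (κ.isOpen_layerSubgroup n)
    (fun σ S T => (contPairingOfFun ρM N e hμ hadd₁ hadd₂ hgal).toLin_smul σ S T) (Sum.inr v) a' u]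
  -- orbit sum, read in the layer currency
  have hsum : (((pairing ρM ρM (mu ℚ N) (pairingHomOfFun N e hμ hadd₁ hadd₂)
        (fun σ S T => (contPairingOfFun ρM N e hμ hadd₁ hadd₂ hgal).toLin_smul σ S T)).coindFin (κ.layerSubgroup n)).restrict
        (absGaloisRestrict ℚ (Place.Completion (Sum.inr v : Place ℚ)))).cupProduct a' u =
      ∑ i, (layerSumPairingOf ρM N e hμ hadd₁ hadd₂ hgal κ v n).cupProduct (layerShapiroOf ρM κ v n (x i))
        (layerShapiroOf ρM κ v n (b i)) := by
    refine (cupProduct_restrict_coindFin_eq_sum_orbits (contPairingOfFun ρM N e hμ hadd₁ hadd₂ hgal) (κ.layerSubgroup n)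
      (resGalOfEmb (closureEmb (K := ℚ) (v.adicCompletion ℚ))) g hbij a' u).trans (Finset.sum_congr rfl fun i _ => ?_)
    calc _ = (layerSumPairingOf ρM N e hμ hadd₁ hadd₂ hgal κ v n).cupProduct
          (cohomologyMap (resCoindFinHomR ρM.toTopRep (κ.layerSubgroup n)
            (resGalOfEmb (closureEmb (K := ℚ) (v.adicCompletion ℚ))) (g i : absoluteGaloisGroup ℚ ⧸ κ.layerSubgroup n)) 1 a')
          (cohomologyMap (resCoindFinHomR ρM.toTopRep (κ.layerSubgroup n)
            (resGalOfEmb (closureEmb (K := ℚ) (v.adicCompletion ℚ))) (g i : absoluteGaloisGroup ℚ ⧸ κ.layerSubgroup n)) 1 u) := rfl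
      _ = _ := by rw [hx i, hb i]
  have hsum' := congrArg (invAt N v) hsum
  rw [map_sum] at hsum'
  exact hsum'.trans (Finset.sum_congr rfl fun i _ => (layerPairingH1Of_apply ρM N e hμ hadd₁ hadd₂ hgal κ v n (x i) (b i)).symm)

omit [Finite M] [NeZero N] in
/-- **Every local class of `Maps(Γ_ℚ ⧸ Γ_n, M)|_{Γ_v}` has a LAYER FAMILY**: for `z ∈ H¹(Γ_v, Maps(Γ_ℚ ⧸ Γ_n, M)|_θ)` there are layer classes
`x_i ∈ H¹(U_n, M|)` with `H¹(Φ_{g_iΓ_n}) z = Sh(x_i)` (Shapiro is onto in degree one, per orbit). With `localTatePairingZMod_canonical_coind_eq_sum_layerPairingH1Of`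
this reads BOTH factors of the local term at `v` in layer currency. [cite: NeukirchSchmidtWingberg2008, I §6 Prop. (1.6.4)] -/
theorem exists_layerFamily_eq {ι : Type} (g : ι → absoluteGaloisGroup ℚ)
    (z : continuousCohomology 1 (TopRep.res (resGalOfEmb (closureEmb (K := ℚ) (v.adicCompletion ℚ)) :
      absoluteGaloisGroup (v.adicCompletion ℚ) →* absoluteGaloisGroup ℚ) (coindFin ρM.toTopRep (κ.layerSubgroup n)))) :
    ∃ x : ι → continuousCohomology 1 (subgroupRep (localRepOf ρM v) (layerGroup κ v n)),
      ∀ i, cohomologyMap (resCoindFinHomR ρM.toTopRep (κ.layerSubgroup n) (resGalOfEmb (closureEmb (K := ℚ) (v.adicCompletion ℚ)))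
        (g i : absoluteGaloisGroup ℚ ⧸ κ.layerSubgroup n)) 1 z = layerShapiroOf ρM κ v n (x i) := by
  choose x hx using fun i => shapiroLift_surjective (localRepOf ρM v) (layerGroup κ v n) (isOpen_layerGroup κ v n)
    (layerReps_spec κ v n) (layerReps_one κ v n)
    (cohomologyMap (resCoindFinHomR ρM.toTopRep (κ.layerSubgroup n) (resGalOfEmb (closureEmb (K := ℚ) (v.adicCompletion ℚ)))
      (g i : absoluteGaloisGroup ℚ ⧸ κ.layerSubgroup n)) 1 z)
  exact ⟨x, fun i => (hx i).symm⟩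

end Layer

end ThetaTransport.LayerPairingNondegenerate

end Summit.BirchSwinnertonDyer.BirchSwinnertonDyer.Theorems

end
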